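import Literature.AlgebraicGeometry.RelativeSpec.GeometricQuotient
import Literature.AlgebraicGeometry.Motives.CartierDivisorIdealSheaf
import Literature.AlgebraicGeometry.Motives.RatFnFlatDescent
import Literature.AlgebraicGeometry.Motives.FunctionFieldOver
import Literature.RingTheory.GaloisAlgebras.ChaseHarrisonRosenbergDescent
import HarnessLib

/-!
# An invariant effective Cartier divisor descends along a free finite quotient

Layer `Literature/AlgebraicGeometry/Motives`, namespace `Literature.AlgebraicGeometry.Motives` (dot notation on
`CartierDivisor`, auxiliary lemmas under `RatFn` and `CartierDivisor`).  THEOREMS ONLY (no definition, no named fact,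
no instance, no `sorry`).

Setting: integral schemes `X`, `Q`, a morphism `p : X → Q` which is affine, dominant and flat, and an action `ρ` of a finite
group `G` on `X` over `p` (★ `RelativeSpec.ActionOver`) for which `p` is a GEOMETRIC QUOTIENT ([MumfordAV1970] §7 Thm. p. 66,
(1)–(2); ★ `ActionOver.IsGeometricQuotient`: fibres = orbits, `p` open and surjective, `Γ(Q, V) = Γ(X, p⁻¹V)^G`) and FREE
in the Chase–Harrison–Rosenberg sense on the affine charts `p⁻¹V` (the hypothesis `hfree` of ★
`RelativeSpec/EquivariantModuleDescent`, verbatim).  For an abelian variety and a finite subgroup `K` of points acting by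
translations these are ★ (`AbelianSchemes/AbelianSchemeConstSubgroupQuotient`, `Motives/AbelianVarietyIsogenyGeometricQuotient`).

Main result ([MumfordAV1970] §12 Thm. 1 (p. 112) «`L ↦ p^*L` is an equivalence between sheaves on `X/G` and `G`-sheaves on
`X`», here for the `G`-SUBSHEAF `𝒪_X(−E) ⊆ 𝒪_X = p^*𝒪_Q` of an invariant effective Cartier divisor, whose linearisation is
the induced one; [Greither1992CyclicGalois] Ch. 0 Thm. 7.1 for the affine descent formula):

* **`CartierDivisor.exists_sameDivisor_pullback_of_isGeometricQuotient`** — an EFFECTIVE Cartier divisor `E` on `X` which is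
  invariant AS A DIVISOR (`(E.pullback σ_g).SameDivisor E` for all `g`, i.e. the subscheme `E` is `G`-stable — invariance
  of the CLASS is not enough) is the pull-back of an effective Cartier divisor `E₀` on `Q`: `(E₀.pullback p).SameDivisor E`.

Road (no module-level linearisation is built): on an affine chart `V ⊆ Q` the ideal `I(V) = Γ(p⁻¹V, 𝒪_X(−E))` (★
`CartierDivisor.sectionIdeal`) is `G`-stable (§2); the Chase–Harrison–Rosenberg DESCENT FORMULA ★
`sum_smul_sum_smul_smul_eq_self` applied to the `G`-module `Γ(X, p⁻¹V)` itself writes every `m ∈ I(V)` as a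
`Γ(X, p⁻¹V)`-combination of INVARIANT elements of `I(V)` (§3); since `𝒪_{X,y}` is local, one of them is a local equation of
`E` at a given point `y` (§1, §4), and an invariant local equation at `y` is — `E` being invariant — a local equation on a
`G`-stable open neighbourhood of the whole fibre `p⁻¹(p y)` (§4); invariant sections are `p^♯` of sections of `Q` (Mumford's
(2)), the images `p(O)` of `G`-stable opens are open with `p⁻¹(p(O)) = O` (Mumford's (1)), and units / regularity descend
along the flat `p` (★ `RatFn.IsRegularAt.of_functionFieldMap`) — which glues the local equations to `E₀` (§5).

Purpose (cell `hodgecm-mathlib`, D-0151; (V)-upgrade road (ii-a″) «theta functions without theta groups», file G2 of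
B-p03 (g17)'s memo `CENSUS-Vup-HalfOfLambda` §2; B-plan1 (g16) 07:53:38Z / 07:57:42Z): the generic core of G2 — the
`A[2]`-invariant effective divisor `E` of G1 descends along `A → A/A[2]`.  Count-neutral; HC_CM is proved only modulo the
7 printed citations until rung 0 closes.

## References
* [MumfordAV1970] D. Mumford, *Abelian Varieties* (1970), §7 Thm. p. 66 ((1), (2)) and Prop. 2 (p. 70), §12 Thm. 1 (p. 112).
* [Greither1992CyclicGalois] C. Greither, *Cyclic Galois Extensions of Commutative Rings*, LNM 1534 (1992), Ch. 0 Thm. 7.1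
  (pp. 28–29).
* [GortzWedhorn2020] U. Görtz, T. Wedhorn, *Algebraic Geometry I* (2nd ed., 2020), Remark 11.27 and (11.12) (p. 305),
  Def. 11.49 / Prop. 11.50 (pp. 315–316), Prop. 14.11 (p. 431).
-/

set_option autoImplicit false

noncomputable section

-- `Scheme.Opens`/`affineOpens` coercions and `Γ(X, ↑V)` (as in ★ `Motives/CartierDivisorIdealSheaf`).
set_option backward.isDefEq.respectTransparency false

universe u

open CategoryTheory AlgebraicGeometry TopologicalSpace Opposite
open Literature.AlgebraicGeometry.RelativeSpec

namespace Literature.AlgebraicGeometry.Motives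

/-! ## §1 Local-ring bookkeeping for rational functions -/

namespace RatFn

variable {X : Scheme.{u}} [IsIntegral X] {x : X}

/-- **If a finite sum `∑ a_q b_q` of products of functions regular at `x` is a unit at `x`, some `b_q` is a unit at `x`**
(`𝒪_{X,x}` is a local ring: the regular non-units form its maximal ideal). [cite: GortzWedhorn2020, Prop. 3.29 (p. 80)] -/
theorem exists_isUnitAt_of_isUnitAt_sum {ι : Type*} (s : Finset ι) (a b : ι → X.functionField)
    (ha : ∀ q ∈ s, IsRegularAt x (a q)) (hb : ∀ q ∈ s, IsRegularAt x (b q))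
    (h : IsUnitAt x (∑ q ∈ s, a q * b q)) : ∃ q ∈ s, IsUnitAt x (b q) := by
  classical
  by_contra hne
  have ha' : ∀ q ∈ s, ∃ α : X.presheaf.stalk x, toFunctionField x α = a q := fun q hq => RingHom.mem_range.mp (ha q hq)
  have hb' : ∀ q ∈ s, ∃ β : X.presheaf.stalk x, toFunctionField x β = b q := fun q hq => RingHom.mem_range.mp (hb q hq)
  choose α hα using ha'
  choose β hβ using hb'
  -- every `β_q` lies in the maximal ideal
  have hmem : ∀ (q : ι) (hq : q ∈ s), β q hq ∈ IsLocalRing.maximalIdeal (X.presheaf.stalk x) := by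
    intro q hq
    rw [IsLocalRing.mem_maximalIdeal, mem_nonunits_iff]
    intro hu
    exact hne ⟨q, hq, hu.unit, by rw [IsUnit.unit_spec]; exact hβ q hq⟩
  have hsum : (∑ q ∈ s.attach, α q.1 q.2 * β q.1 q.2) ∈ IsLocalRing.maximalIdeal (X.presheaf.stalk x) :=
    Ideal.sum_mem _ fun q _ => Ideal.mul_mem_left _ _ (hmem q.1 q.2)
  obtain ⟨u, hu⟩ := h
  have hu' : (u : X.presheaf.stalk x) = ∑ q ∈ s.attach, α q.1 q.2 * β q.1 q.2 := by
    apply toFunctionField_injective x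
    rw [hu, map_sum, ← Finset.sum_attach s]
    exact Finset.sum_congr rfl fun q _ => by rw [map_mul, hα q.1 q.2, hβ q.1 q.2]
  exact (IsLocalRing.mem_maximalIdeal _).1 (hu' ▸ hsum) u.isUnit

/-- `(g ≫ f)^♯ = g^♯ ∘ f^♯` on an element. [cite: GortzWedhorn2020, Def. 11.49 and Prop. 11.50 (pp. 315–316)] -/
theorem functionFieldMap_comp_apply {X' X'' : Scheme.{u}} [IsIntegral X'] [IsIntegral X''] (f : X' ⟶ X) [IsDominant f]
    (g : X'' ⟶ X') [IsDominant g] [IsDominant (g ≫ f)] (h : X.functionField) :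
    functionFieldMap (g ≫ f) h = functionFieldMap g (functionFieldMap f h) := by
  rw [functionFieldMap_comp f g]; rfl

/-- `f^♯ = f'^♯` for `f = f'`. [folklore] -/
private theorem functionFieldMap_congr' {X' : Scheme.{u}} [IsIntegral X'] {f f' : X' ⟶ X} (e : f = f') [IsDominant f]
    [IsDominant f'] (h : X.functionField) : functionFieldMap f h = functionFieldMap f' h := by
  subst e; rfl

/-- **Units descend along flat morphisms** (`π^♯ e` a unit at `w` ⇒ `e` a unit at `π w`; ★
`IsRegularAt.of_functionFieldMap` for `e` and `e⁻¹`). [cite: GortzWedhorn2020, Prop. 14.11 (p. 431)] -/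
theorem IsUnitAt.of_functionFieldMap_flat {W : Scheme.{u}} [IsIntegral W] (π : W ⟶ X) [IsDominant π] [Flat π] {w : W}
    {e : X.functionField} (he : RatFn.IsUnitAt w (RatFn.functionFieldMap π e)) : RatFn.IsUnitAt (π w) e := by
  rw [isUnitAt_iff] at he ⊢
  obtain ⟨h0, hreg, hreg'⟩ := he
  refine ⟨fun h => h0 (by rw [h, map_zero]), RatFn.IsRegularAt.of_functionFieldMap π hreg, ?_⟩
  rw [← map_inv₀] at hreg'
  exact RatFn.IsRegularAt.of_functionFieldMap π hreg'

/-- The rational function of `f^*(r)|_W` (`Scheme.Hom.appLE`) is `f^♯` of the rational function of `r`.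
[cite: GortzWedhorn2020, Def. 11.49 and Prop. 11.50 (pp. 315–316)] -/
theorem secFn_appLE {Y : Scheme.{u}} [IsIntegral Y] (f : X ⟶ Y) [IsDominant f] {U : Y.Opens} {W : X.Opens}
    (e : W ≤ f ⁻¹ᵁ U) {x : X} (hx : x ∈ W) (r : Γ(Y, U)) :
    secFn hx (f.appLE U W e r) = functionFieldMap f (secFn (e hx) r) := by
  rw [Scheme.Hom.appLE, CommRingCat.comp_apply]
  change ofSection _ (X.presheaf.map (homOfLE e).op (f.app U r)) = _
  rw [ofSection_map, functionFieldMap_ofSection]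

/-- The rational function of `f^*(r)` (`Scheme.Hom.app`) is `f^♯` of the rational function of `r`.
[cite: GortzWedhorn2020, Def. 11.49 and Prop. 11.50 (pp. 315–316)] -/
theorem secFn_app {Y : Scheme.{u}} [IsIntegral Y] (f : X ⟶ Y) [IsDominant f] {U : Y.Opens} {x : X}
    (hx : x ∈ f ⁻¹ᵁ U) (r : Γ(Y, U)) :
    secFn hx (f.app U r) = functionFieldMap f (secFn (show f x ∈ U from hx) r) := by
  change ofSection _ _ = _
  rw [functionFieldMap_ofSection]

/-- The rational function of a finite sum of sections. [folklore] -/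
private theorem secFn_sum {U : X.Opens} {x : X} (hx : x ∈ U) {ι : Type*} (s : Finset ι) (t : ι → Γ(X, U)) :
    secFn hx (∑ q ∈ s, t q) = ∑ q ∈ s, secFn hx (t q) := by
  classical
  induction s using Finset.induction_on with
  | empty => rw [Finset.sum_empty, Finset.sum_empty, secFn_zero]
  | insert a s ha ih => rw [Finset.sum_insert ha, Finset.sum_insert ha, secFn_add, ih]

end RatFn

open RatFn

namespace CartierDivisor

variable {X : Scheme.{u}} [IsIntegral X] (E : CartierDivisor X)

/-! ## §2 Invariance of `E` as a divisor: pull-back of sections of `𝒪_X(−E)` -/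

/-- **Invariance in rational-function terms**: if `σ^*E` and `E` are the same divisor, then `σ^♯ f_j / f_i` is a unit at every
`y ∈ σ⁻¹U_j ∩ U_i`. [cite: GortzWedhorn2020, Def. 11.49 and Prop. 11.50 (pp. 315–316)] -/
theorem isUnitAt_functionFieldMap_f_div {X' : Scheme.{u}} [IsIntegral X'] (σ : X' ⟶ X) [IsDominant σ]
    {E' : CartierDivisor X'} (hinv : (E.pullback σ).SameDivisor E') {j : E.ι} {i : E'.ι} {y : X'} (hj : σ y ∈ E.U j)
    (hi : y ∈ E'.U i) : IsUnitAt y (functionFieldMap σ (E.f j) / E'.f i) := by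
  have := hinv j i y hj hi
  rwa [pullback_f] at this

/-- **A regular multiple of the pulled-back equation is a regular multiple of the equation**: if `σ^*E` and `E'` are the same
divisor and `h / f_j` is regular at `σ y` (`σ y ∈ U_j`), then `σ^♯ h / f'_i` is regular at `y ∈ U'_i`.
[cite: GortzWedhorn2020, Remark 11.27 and (11.12) (p. 305)] -/
theorem isRegularAt_functionFieldMap_div {X' : Scheme.{u}} [IsIntegral X'] (σ : X' ⟶ X) [IsDominant σ]
    {E' : CartierDivisor X'} (hinv : (E.pullback σ).SameDivisor E') {h : X.functionField} {j : E.ι} {i : E'.ι} {y : X'}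
    (hj : σ y ∈ E.U j) (hi : y ∈ E'.U i) (hreg : IsRegularAt (σ y) (h / E.f j)) :
    IsRegularAt y (functionFieldMap σ h / E'.f i) := by
  have h1 : IsRegularAt y (functionFieldMap σ h / functionFieldMap σ (E.f j)) := by
    rw [← map_div₀]; exact hreg.functionFieldMap
  have h2 := (E.isUnitAt_functionFieldMap_f_div σ hinv hj hi).isRegularAt
  have := h1.mul h2
  rwa [div_mul_div_cancel₀ ((map_ne_zero _).2 (E.f_ne_zero j))] at this

/-- The same for units: if `h / f_j` is a unit at `σ y` then `σ^♯ h / f'_i` is a unit at `y`.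
[cite: GortzWedhorn2020, Remark 11.27 and (11.12) (p. 305)] -/
theorem isUnitAt_functionFieldMap_div {X' : Scheme.{u}} [IsIntegral X'] (σ : X' ⟶ X) [IsDominant σ]
    {E' : CartierDivisor X'} (hinv : (E.pullback σ).SameDivisor E') {h : X.functionField} {j : E.ι} {i : E'.ι} {y : X'}
    (hj : σ y ∈ E.U j) (hi : y ∈ E'.U i) (hu : IsUnitAt (σ y) (h / E.f j)) :
    IsUnitAt y (functionFieldMap σ h / E'.f i) := by
  have h1 : IsUnitAt y (functionFieldMap σ h / functionFieldMap σ (E.f j)) := by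
    rw [← map_div₀]; exact hu.functionFieldMap
  have := h1.mul (E.isUnitAt_functionFieldMap_f_div σ hinv hj hi)
  rwa [div_mul_div_cancel₀ ((map_ne_zero _).2 (E.f_ne_zero j))] at this

/-- Conversely (for `σ` flat, e.g. an automorphism): if `σ^♯ h / f'_i` is a unit at `y ∈ U'_i` then `h / f_j` is a unit at
`σ y ∈ U_j`. [cite: GortzWedhorn2020, Prop. 14.11 (p. 431)] -/
theorem isUnitAt_div_of_functionFieldMap {X' : Scheme.{u}} [IsIntegral X'] (σ : X' ⟶ X) [IsDominant σ] [Flat σ]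
    {E' : CartierDivisor X'} (hinv : (E.pullback σ).SameDivisor E') {h : X.functionField} {j : E.ι} {i : E'.ι} {y : X'}
    (hj : σ y ∈ E.U j) (hi : y ∈ E'.U i) (hu : IsUnitAt y (functionFieldMap σ h / E'.f i)) :
    IsUnitAt (σ y) (h / E.f j) := by
  have h1 := hu.mul (E.isUnitAt_functionFieldMap_f_div σ hinv hj hi).inv
  rw [inv_div, div_mul_div_cancel₀ (E'.f_ne_zero i), ← map_div₀] at h1
  exact IsUnitAt.of_functionFieldMap_flat σ h1

/-- **The sections of `𝒪_X(−E)` are stable under an automorphism preserving `E`**: for `σ : X → X` with `σ^*E` the same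
divisor as `E` and an affine open `V` with `V ⊆ σ⁻¹V`, `σ^*` maps `Γ(V, 𝒪_X(−E))` (★ `sectionIdeal`) into itself.
[cite: GortzWedhorn2020, Remark 11.27 and (11.12) (p. 305)] -/
theorem appLE_mem_sectionIdeal (σ : X ⟶ X) [IsDominant σ] (hinv : (E.pullback σ).SameDivisor E) (V : X.affineOpens)
    (e : (V : X.Opens) ≤ σ ⁻¹ᵁ (V : X.Opens)) {s : Γ(X, V)} (hs : s ∈ E.sectionIdeal V) :
    σ.appLE V V e s ∈ E.sectionIdeal V := by
  intro i y hy hyi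
  obtain ⟨j, hj⟩ := E.covers (σ y)
  rw [secFn_appLE σ e hy]
  exact E.isRegularAt_functionFieldMap_div σ hinv hj hyi (hs j (σ y) (e hy) hj)

/-! ## §3 A local equation of `E` among the sections of `𝒪_X(−E)` over a big affine open -/

/-- **On an affine open `U ∋ y`, some section of `𝒪_X(−E)` over ALL of `U` is a local equation of `E` at `y`** (`E`
effective): near `y ∈ U_i` the equation `f_i` is a section `t` on an affine `W ⊆ U ∩ U_i`; on a basic open `U_b ⊆ W` of `U`
through `y`, `t = m / b^k` with `m ∈ Γ(U)`; then `b^n m ∈ Γ(U, 𝒪_X(−E))` for some `n` (★ `exists_pow_mul_mem_sectionIdeal`)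
and `b^n m / f_i = b^{n+k}` is a unit at `y`. [cite: GortzWedhorn2020, Remark 11.27 and (11.12) (p. 305)] -/
theorem IsEffective.exists_mem_sectionIdeal_isUnitAt {E : CartierDivisor X} (hE : E.IsEffective) (U : X.affineOpens)
    {y : X} (hyU : y ∈ (U : X.Opens)) {i : E.ι} (hyi : y ∈ E.U i) :
    ∃ m ∈ E.sectionIdeal U, IsUnitAt y (secFn hyU m / E.f i) := by
  -- `f_i` is a section `t` on an affine `W ⊆ U ∩ U_i` through `y`
  obtain ⟨W, hyW, hWi, hWU, t, ht⟩ := hE.exists_affine_secFn_eq hyi (O := (U : X.Opens)) hyU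
  -- a basic open `U_b ⊆ W` of `U` through `y`
  obtain ⟨b, hbW, hyb⟩ := U.2.exists_basicOpen_le ⟨y, hyW⟩ hyU
  have hbU : X.basicOpen b ≤ (U : X.Opens) := X.basicOpen_le b
  -- `t|_{U_b} = m / b^k`
  haveI := U.2.isLocalization_basicOpen b
  obtain ⟨⟨m, ⟨_, k, rfl⟩⟩, hm⟩ :=
    IsLocalization.surj (Submonoid.powers b) (X.presheaf.map (homOfLE hbW).op t)
  -- so `secFn m = secFn b ^ k * f_i`
  have hmf : secFn hyU m = secFn hyU b ^ k * E.f i := by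
    have := congrArg (secFn hyb) hm
    change secFn hyb (X.presheaf.map (homOfLE hbW).op t * X.presheaf.map (homOfLE hbU).op (b ^ k)) =
      secFn hyb (X.presheaf.map (homOfLE hbU).op m) at this
    rw [secFn_mul, secFn_map hbW hyb, secFn_map hbU hyb, secFn_map hbU hyb, secFn_congr hyW hyW, ht,
      secFn_pow] at this
    rw [← this, mul_comm]
  -- `b^n m ∈ 𝒪_X(−E)(U)`
  obtain ⟨n, hn⟩ := hE.exists_pow_mul_mem_sectionIdeal U b m fun j z hz hzj hzb => by
    have hzi : z ∈ E.U i := hWi (hbW hzb)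
    rw [secFn_congr hz hyU, hmf, mul_div_assoc]
    exact ((isRegularAt_secFn hyU hz b).pow k).mul (E.isUnitAt_div i j z hzi hzj).isRegularAt
  refine ⟨b ^ n * m, hn, ?_⟩
  rw [secFn_mul, secFn_pow, hmf, ← mul_assoc, ← pow_add, mul_div_cancel_right₀ _ (E.f_ne_zero i)]
  exact ((isUnitAt_secFn_iff hyU hyU b).2 hyb).pow _

end CartierDivisor

/-! ## §4 The quotient setting: invariant sections come from `Q`, and an invariant local equation near every fibre -/

namespace CartierDivisor

variable {X Q : Scheme.{u}} [IsIntegral X] [IsIntegral Q] {p : X ⟶ Q} [IsAffineHom p] [IsDominant p]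
  {G : Type*} [Group G] [Finite G] (ρ : ActionOver p G) (hq : ρ.IsGeometricQuotient p)
  (hfree : ∀ (V : Q.Opens), IsAffineOpen V → ∀ g : G, g ≠ 1 →
    Ideal.span (Set.range fun b : Γ(X, p ⁻¹ᵁ V) ↦ ρ.act g V b - b) = ⊤)
  (E : CartierDivisor X) (hE : E.IsEffective) (hinv : ∀ g : G, (E.pullback (ρ.aut g).hom).SameDivisor E)

omit [IsIntegral Q] [IsDominant p] [Finite G] in
include hinv in
/-- The sections of `𝒪_X(−E)` over `p⁻¹V` are `G`-stable. [cite: MumfordAV1970, §12 Thm. 1 (p. 112)] -/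
theorem act_mem_sectionIdeal {V : Q.Opens} (hV : IsAffineOpen V) (g : G) {s : Γ(X, p ⁻¹ᵁ V)}
    (hs : s ∈ E.sectionIdeal ⟨p ⁻¹ᵁ V, hV.preimage p⟩) :
    ρ.act g V s ∈ E.sectionIdeal ⟨p ⁻¹ᵁ V, hV.preimage p⟩ := by
  rw [ActionOver.act_apply]
  exact E.appLE_mem_sectionIdeal (ρ.aut g⁻¹).hom (hinv g⁻¹) ⟨p ⁻¹ᵁ V, hV.preimage p⟩ _ hs

omit [IsIntegral Q] [IsDominant p] in
include hq hfree hE hinv in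
/-- **An INVARIANT local equation from the descent formula**: for `V ⊆ Q` affine and `y ∈ p⁻¹V`, some section `a ∈ Γ(Q, V)`
pulls back to a local equation `p^♯a` of `E` at `y` — every `m ∈ I := Γ(p⁻¹V, 𝒪_X(−E))` is `∑ₚ xₚ · nₚ` with `nₚ ∈ I`
INVARIANT (Chase–Harrison–Rosenberg descent formula ★ `sum_smul_sum_smul_smul_eq_self`, `nₚ = ∑_g g·(yₚ m)`), a local equation
`m ∈ I` at `y` exists (§3), so some `nₚ` is one (`𝒪_{X,y}` local, §1), and invariant sections are `p^♯` of sections of `Q`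
(Mumford's (2)). [cite: Greither1992CyclicGalois, Ch. 0 Thm. 7.1 (pp. 28–29)] [cite: MumfordAV1970, §7 Thm. p. 66 (2) and §12 Thm. 1 (p. 112)] -/
theorem exists_app_isUnitAt_div {V : Q.Opens} (hV : IsAffineOpen V) {y : X} (hy : y ∈ p ⁻¹ᵁ V) {i : E.ι}
    (hyi : y ∈ E.U i) :
    ∃ a : Γ(Q, V), p.app V a ∈ E.sectionIdeal ⟨p ⁻¹ᵁ V, hV.preimage p⟩ ∧ IsUnitAt y (secFn hy (p.app V a) / E.f i) := by
  classical
  let _ : Fintype G := Fintype.ofFinite G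
  -- the rings `A = Γ(Q, V) → B = Γ(X, p⁻¹V)` with the free `G`-action on `B` (as in ★ T1)
  letI : Algebra Γ(Q, V) Γ(X, p ⁻¹ᵁ V) := (p.app V).hom.toAlgebra
  letI : MulSemiringAction G Γ(X, p ⁻¹ᵁ V) := ρ.mulSemiringAction V
  haveI : SMulCommClass G Γ(Q, V) Γ(X, p ⁻¹ᵁ V) :=
    ⟨fun g a b => by
      change ρ.act g V (p.app V a * b) = p.app V a * ρ.act g V b
      rw [map_mul, ρ.act_app]⟩
  haveI : SMulDistribClass G Γ(X, p ⁻¹ᵁ V) Γ(X, p ⁻¹ᵁ V) := ⟨fun g b m => smul_mul' g b m⟩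
  have hfree' : ∀ g : G, g ≠ 1 →
      Ideal.span (Set.range fun b : Γ(X, p ⁻¹ᵁ V) ↦ g • b - b) = ⊤ := hfree V hV
  obtain ⟨s, hs₁, hs⟩ := Literature.RingTheory.GaloisAlgebras.exists_finset_sum_mul_smul_of_free Γ(Q, V) G hfree'
  -- a local equation `m ∈ I` at `y`
  set I := E.sectionIdeal ⟨p ⁻¹ᵁ V, hV.preimage p⟩ with hI
  obtain ⟨m, hmI, hmu⟩ := hE.exists_mem_sectionIdeal_isUnitAt ⟨p ⁻¹ᵁ V, hV.preimage p⟩ hy hyi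
  -- the descent formula: `m = ∑ₚ xₚ · nₚ`, `nₚ := ∑_g g · (yₚ m) ∈ I` invariant
  have hformula := Literature.RingTheory.GaloisAlgebras.sum_smul_sum_smul_smul_eq_self (M := Γ(X, p ⁻¹ᵁ V)) hs₁ hs m
  simp only [smul_eq_mul] at hformula
  have hnI : ∀ q ∈ s, (∑ g : G, g • (q.2 * m)) ∈ I := fun q _ =>
    Ideal.sum_mem _ fun g _ => by
      rw [ActionOver.smul_def]
      exact E.act_mem_sectionIdeal ρ hinv hV g (Ideal.mul_mem_left _ _ hmI)
  have hninv : ∀ q ∈ s, ∀ g : G, ρ.act g V (∑ g' : G, g' • (q.2 * m)) = ∑ g' : G, g' • (q.2 * m) := by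
    intro q _ g
    rw [map_sum]
    simp_rw [ActionOver.smul_def, ← RingHom.comp_apply, ← ActionOver.act_mul]
    exact Fintype.sum_equiv (Equiv.mulLeft g) _ _ fun _ => rfl
  -- one `nₚ` is a local equation at `y`
  obtain ⟨q, hq', hqu⟩ := exists_isUnitAt_of_isUnitAt_sum s (fun q => secFn hy q.1)
    (fun q => secFn hy (∑ g : G, g • (q.2 * m)) / E.f i) (fun q _ => isRegularAt_secFn hy hy q.1)
    (fun q hq' => hnI q hq' i y hy hyi) (by
      have : ∑ q ∈ s, secFn hy q.1 * (secFn hy (∑ g : G, g • (q.2 * m)) / E.f i) = secFn hy m / E.f i := by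
        rw [← congrArg (fun z => secFn hy z / E.f i) hformula]
        change _ = secFn hy (∑ q ∈ s, q.1 * ∑ g : G, g • (q.2 * m)) / E.f i
        rw [RatFn.secFn_sum, Finset.sum_div]
        exact Finset.sum_congr rfl fun q _ => by rw [secFn_mul, mul_div_assoc]
      rw [this]; exact hmu)
  -- it is invariant, hence `p^♯ a`
  obtain ⟨a, ha⟩ := hq.exists_app_eq V (∑ g : G, g • (q.2 * m)) fun g _ => hninv q hq' g
  exact ⟨a, ha ▸ hnI q hq', ha ▸ hqu⟩

include hq hfree hE hinv in
/-- **An invariant local equation on a `G`-stable open neighbourhood of a whole fibre.**  For every `y ∈ X` there are an open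
`V ∋ p y` of `Q`, a section `a ∈ Γ(Q, V)` and a `G`-STABLE open `O` with `y ∈ O ⊆ p⁻¹V` such that the rational function
`p^♯a` is a local equation of `E` at every point of `O`: an invariant local equation at `y` is one along the orbit `G·y =
p⁻¹(p y)` and on the (open, `G`-stable) locus where it is one, because `E` and `p^♯a` are both `G`-invariant.
[cite: MumfordAV1970, §7 Thm. p. 66 (1)–(2) and §12 Thm. 1 (p. 112)] -/
theorem exists_stable_open_isUnitAt_div (y : X) :
    ∃ (V : Q.Opens) (hV : genericPoint Q ∈ V) (a : Γ(Q, V)) (O : X.Opens), y ∈ O ∧ O ≤ p ⁻¹ᵁ V ∧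
      (∀ g : G, (ρ.aut g).hom '' (O : Set X) ⊆ O) ∧
      ∀ z ∈ O, ∀ j : E.ι, z ∈ E.U j → IsUnitAt z (functionFieldMap p (ofSection hV a) / E.f j) := by
  -- an affine open `V ∋ p y` and an invariant local equation `p^♯ a` at `y`
  obtain ⟨_, ⟨V, hV, rfl⟩, hyV, -⟩ := Q.isBasis_affineOpens.exists_subset_of_mem_open (Set.mem_univ (p y)) isOpen_univ
  change p y ∈ V at hyV
  obtain ⟨i, hyi⟩ := E.covers y
  obtain ⟨a, -, hau⟩ := E.exists_app_isUnitAt_div ρ hq hfree hE hinv hV (y := y) hyV hyi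
  have hVη : genericPoint Q ∈ V := genericPoint_mem_of_mem hyV
  have hφ : secFn (show y ∈ p ⁻¹ᵁ V from hyV) (p.app V a) = functionFieldMap p (ofSection hVη a) := by
    rw [secFn_app]
  -- `φ := p^♯ a` is `G`-invariant
  set φ := functionFieldMap p (ofSection hVη a) with hφdef
  have hφinv : ∀ g : G, functionFieldMap (ρ.aut g).hom φ = φ := by
    intro g
    haveI : IsDominant ((ρ.aut g).hom ≫ p) := by rw [ρ.aut_comp]; infer_instance
    rw [hφdef, ← functionFieldMap_comp_apply, functionFieldMap_congr' (ρ.aut_comp g)]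
  -- the locus `O` where `φ` is a local equation of `E`, inside `p⁻¹V`
  let O : X.Opens := ⟨{z | z ∈ p ⁻¹ᵁ V ∧ ∃ j, z ∈ E.U j ∧ IsUnitAt z (φ / E.f j)}, by
    have : {z : X | z ∈ p ⁻¹ᵁ V ∧ ∃ j, z ∈ E.U j ∧ IsUnitAt z (φ / E.f j)} =
        (p ⁻¹ᵁ V : Set X) ∩ ⋃ j, ((E.U j : Set X) ∩ {z | IsUnitAt z (φ / E.f j)}) := by
      ext z; simp [Set.mem_iUnion]
    rw [this]
    exact (p ⁻¹ᵁ V).2.inter (isOpen_iUnion fun j => (E.U j).2.inter (isOpen_setOf_isUnitAt _))⟩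
  -- on `O`, `φ` is a local equation in EVERY chart
  have hO : ∀ z ∈ O, ∀ j : E.ι, z ∈ E.U j → IsUnitAt z (φ / E.f j) := by
    rintro z ⟨-, j', hzj', hu⟩ j hzj
    have := hu.mul (E.isUnitAt_div j' j z hzj' hzj)
    rwa [div_mul_div_cancel₀ (E.f_ne_zero j')] at this
  refine ⟨V, hVη, a, O, ⟨hyV, i, hyi, hφ ▸ hau⟩, fun z hz => hz.1, fun g => ?_, hO⟩
  -- `O` is `G`-stable
  rintro _ ⟨z, hz, rfl⟩
  obtain ⟨j, hj⟩ := E.covers ((ρ.aut g).hom z)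
  obtain ⟨i', hi'⟩ := E.covers z
  refine ⟨?_, j, hj, ?_⟩
  · change p ((ρ.aut g).hom z) ∈ V
    rw [hq.apply_aut]; exact hz.1
  · have hz' : IsUnitAt z (functionFieldMap (ρ.aut g).hom φ / E.f i') := by rw [hφinv g]; exact hO z hz i' hi'
    exact E.isUnitAt_div_of_functionFieldMap (ρ.aut g).hom (hinv g) hj hi' hz'

/-! ## §5 The descended divisor -/

include hq hfree hE hinv in
/-- **AN INVARIANT EFFECTIVE CARTIER DIVISOR DESCENDS ALONG A FREE FINITE QUOTIENT.**  Let `p : X → Q` (integral schemes,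
`p` affine, dominant, flat) be a geometric quotient of `X` by the finite group `G` ([MumfordAV1970] §7 Thm. p. 66 (1)–(2))
which is free in the Chase–Harrison–Rosenberg sense on the affine charts (`hfree`), and let `E` be an EFFECTIVE Cartier divisor
on `X` invariant AS A DIVISOR: `(σ_g^*E).SameDivisor E` for all `g`.  Then `E = p^*E₀` for an effective Cartier divisor `E₀`
on `Q` — [MumfordAV1970] §12 Thm. 1 (p. 112) for the `G`-subsheaf `𝒪_X(−E) ⊆ 𝒪_X`: local equations `p^♯a_q` on `G`-stable
opens `O_q ⊇ p⁻¹(q)` (§4) give `E₀ := (p(O_q), a_q)_q`, the images `p(O_q)` being open with `p⁻¹(p(O_q)) = O_q` (Mumford's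
(1)) and the cocycle `a_q / a_{q'}` consisting of units because its pull-back does and `p` is flat and onto.
[cite: MumfordAV1970, §12 Thm. 1 (p. 112) and §7 Thm. p. 66] [cite: Greither1992CyclicGalois, Ch. 0 Thm. 7.1 (pp. 28–29)] -/
theorem exists_sameDivisor_pullback_of_isGeometricQuotient [Flat p] :
    ∃ E₀ : CartierDivisor Q, E₀.IsEffective ∧ (E₀.pullback p).SameDivisor E := by
  classical
  -- for every `q ∈ Q` a point `y_q` over it and the data of §4
  have hsurj := hq.surjective
  choose yq hyq using hsurj
  choose V hV a O hyO hOV hOst hO using fun q : Q => E.exists_stable_open_isUnitAt_div ρ hq hfree hE hinv (yq q)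
  -- the opens `p(O_q)` of `Q`
  have hopen : ∀ q, IsOpen (p '' (O q : Set X)) := fun q => hq.isOpenMap _ (O q).2
  have hpre : ∀ q, p ⁻¹' (p '' (O q : Set X)) = O q := fun q => hq.preimage_image_eq_of_stable (hOst q)
  -- `a_q ≠ 0`
  have ha0 : ∀ q, ofSection (hV q) (a q) ≠ 0 := by
    intro q h0
    obtain ⟨j, hj⟩ := E.covers (yq q)
    have := (hO q (yq q) (hyO q) j hj).ne_zero
    rw [h0, map_zero, zero_div] at this
    exact this rfl
  refine ⟨{ ι := Q
            U := fun q => ⟨p '' (O q : Set X), hopen q⟩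
            covers := fun q => ⟨q, yq q, hyO q, hyq q⟩
            f := fun q => ofSection (hV q) (a q)
            f_ne_zero := ha0
            isUnitAt_div := ?_ }, ?_, ?_⟩
  · -- cocycle: pull back to a point `w` over `z` and descend along the flat `p`
    intro q q' z hz hz'
    obtain ⟨w, rfl⟩ := hq.surjective z
    have hw : w ∈ (O q : Set X) := by rw [← hpre q]; exact hz
    have hw' : w ∈ (O q' : Set X) := by rw [← hpre q']; exact hz'
    obtain ⟨j, hj⟩ := E.covers w
    have h1 := (hO q w hw j hj).mul (hO q' w hw' j hj).inv
    rw [inv_div, div_mul_div_cancel₀ (E.f_ne_zero j), ← map_div₀] at h1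
    exact IsUnitAt.of_functionFieldMap_flat p h1
  · -- effective: `a_q` is a section on `V_q ⊇ p(O_q)`
    intro q z hz
    obtain ⟨w, hw, rfl⟩ := hz
    exact isRegularAt_ofSection (show p w ∈ V q from hOV q hw) (a q)
  · -- `p^*E₀` is the same divisor as `E`
    intro q j z hz hzj
    rw [pullback_f]
    exact hO q z (show z ∈ (O q : Set X) by rw [← hpre q]; exact hz) j hzj

end CartierDivisor

end Literature.AlgebraicGeometry.Motives

end
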